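import Literature.MathematicalPhysics.QuantumFieldTheory.Balaban1983to89.B9SectBCodedFamiliesUParH

/-!
# `Balaban1983to89.B9SectBH2StepUParH` — T. Bałaban, *Propagators for lattice gauge theories in a background field*, Commun. Math. Phys. **99** (1985) 389–434
# [Balaban1985BackgroundPropagators], Thm 3.4 p. 400 with (3.45) p. 398, (3.40) p. 397 and (3.21) p. 394: THE (3.45) MEMBER OF THE SECT.-B STEP FOR THE
# TWO-TRANSPORTER CODED READING `KSCUPar parA parH` — the (3.45) transfer re-threaded with the operator at `parA` and the Hölder quotients at `parH`
# (pub-ymgap N06 [B9]; CASCADE-K step K1, the (C) road, module F3)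

statement-level skeleton of published theorems with citation tags; proofs where landed; nothing here is a claim about the Yang–Mills mass gap

THE PRINT.  (3.45) p. 398: `‖ζ∇_U G′(U)∇*_U λ‖_β ≦ B′₀(ε,β)(Lʲη)^{−β}(…)e^{−δ₀d(y,y′)}(‖λ‖_{β+ε} + |λ|)`, Hölder quotients along (3.40)'s shortest contours; `G′(U)` built
from `Q′(U)` with (3.21)'s averaging contours; Sect. B transports it from `U` to `U′U` (p. 403 l. 2–7).

WHY THIS FILE (pub-ymgap node N06 [B9]; director-ym №383 CASCADE-K, K1 := this seat's lineage; node00-def-Y's RULING on ⚑ FLAG K1-PAR; module F3 of the (C) road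
I.19389).  The tree's (3.45) member of the Sect.-B step of record is `B9SectBH2FrameCodedY(R).stepH2Pos_KSCU_on` for the single-transporter reading `KSCU par`
(core: the 340-line `h2_transfer_KSC₇`, dag-n06-c g12), where `par` sits both in the operator letters and in the probes `probeH (par U)` ∕ `hqS (par U)`.  THIS FILE
re-threads it for the two-transporter frame family `B9SectBCodedFamiliesUParH.KSC₇Par parA parH` (whose Hölder members ARE `KSCUPar parA parH`'s):
* §1 ★ `h2_read_Par` — the (3.45) block of `KSCUPar parA parH` at a base read at a pair (`GpY parA`, `hqS (parH U)`);
* §2 ★★ `h2_transfer_KSC₇Par` — the transfer field (`GopC ∕ GpY` at `parA`; `probeH ∕ quotS ∕ h1ReadT` at `parH`; the (3.43) input through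
  `B9SectBCodedReadingsUParH.KSCUPar_h1_inl`, the (3.44) input through `B9SectBE4FrameCodedY(R).e4_read` at `parA` — the (3.44) member is transporter-blind);
* §3 ★ `h2Frame₃CodedOnPar`, ★ `stepH2Pos_KSC₇Par_on`, ★★★ `stepH2Pos_KSCUPar_on` — THE (3.45) MEMBER OF THE SECT.-B STEP OF RECORD FOR `(KSCUPar parA parH, KACU, C⁻¹)`
  (input transport `hin_KSCUPar_on_pos`, identity output `h2Block_KSC₇Par_iff`).  Binders = those of `B9SectBCodedFamiliesUParH.stepEPos_KSCUPar_on` (laws `hpar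
  hunit hC37` at `parA`); NO law of the Hölder transporter `parH` enters (3.45)'s step.

HONEST SCOPE ∕ NOT CLAIMED.  A re-threading of a landed proof at separated transporter roles + its frame instance and one transported step theorem; displayed laws are
hypotheses; nothing of [B9]'s analysis asserted beyond what g12's proof and r06's uniform transfer (vi′) prove; count-neutral; N06 NOT discharged; nothing continuum ∕ OS ∕
mass gap ∕ Clay.  NEW file; no `sorry`, no `axiom`, no `instance`, no `notation`; one `noncomputable def` (the frame instance).  Cell `pub-ymgap` (D-0062), seat
`pub-ymgap-dag-n06-c` (gen 24), 2026-08-30; `--supports stmt-QuantumFields-27364`.  Net new unproved facts: 0.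

RELATED IN THE TREE, NOT DUPLICATED (searched 2026-08-30: `rg 'h2_transfer_KSC₇Par|h2Frame₃CodedOnPar|stepH2Pos_KSCUPar|h2_read_Par' lean/Literature lean/Summits` —
0 hits): `B9SectBH2FrameCodedY(R)` (`h2_read`, `h2_transfer_KSC₇`, `h2Frame₃CodedOn`, `stepH2Pos_KSCU_on` — the diagonal instance; tools `W2`, `h2word_eq`, `wH2₇`,
`hqS_wordS_liftY_le`, `symm_gradF_G_negGradB_eq` USED), `B9SectBE4FrameCodedY(R)` (`e4_read`, USED at `parA`), `B9SectBCodedFamiliesUParH` (`KSC₇Par`,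
`hin_KSCUPar_on_pos`, USED).
-/

noncomputable section

namespace Literature.MathematicalPhysics.QuantumFieldTheory.Balaban1983to89.B9SectBH2StepUParH

open Literature.MathematicalPhysics.QuantumFieldTheory.Balaban1983to89.B9SectBCodedClassR (RegExtraY bg9YC)
open Literature.MathematicalPhysics.QuantumFieldTheory.Balaban1983to89.B9SectBCodedFamiliesUParH
open Literature.MathematicalPhysics.QuantumFieldTheory.Balaban1983to89.B9SectBH2FrameCodedY
open B6RandomWalk (HasMajorant hasMajorant_mono BlockSupp)
open B6KLevelCensusIndexV1 (KIdx kGeo)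
open B6Ineq2142KLevelV1 (β)
open B6Prop22KLevelTorusCensusEta (nKT nKT_pos hqTP hqTP_nonneg)
open B9Thm34Ext (toB6)
open B9FromB6 (EBlock H1Block E4Block H2Block)
open B9Eq352DivFormLetters (conj coordEquiv gradLetterF gradLetterB gradLetterF_apply)
open B9Eq352GradLetters (diffLetter diffLetter_inl diffLetter_inr)
open B9Thm34SectBUniformR1 (thm34_Gp_uniform)
open B9Thm34HolderGpUniformR1 (thm34_Gp_holderInput_uniform)
open B9SectBGpStepAtLettersV2 (GpFrame₂)
open B9SectBStepWhole (StepPos StepH2Pos)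
open B9SectBCodedCarrier (CCfg Coding pullK pullS)
open B9Eq360DeltaPrimeAY (AfldY blkY)
open B9PinMembersKLevelV1 (MemberY geo9Y bg9Y)
open B9SectBGpLettersY (GVal decY coordC blkC GopC letters_base_of_gVal norm_le_one_and_inv_of_mem stencilB_blkC)
open B9SectBGpFrameCodedYR (codingYx Read342Y Write342Y)
open B9SectBGpFrameCodedY (CplxLettersY)
open B9SectBGpReadingsYR (KSC read342Y_KSC write342Y_KSC)
open B9SectBGpReadingsY (baseY etaS_eq_eta)
open B9SectBCodedReadingsUR (KSCU KACU)
open B9SectBStepsKSCUR (KACU_members_base ineq342_346_347_congr thms_KSCU_base_iff hin_KSCU_on_pos)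
open B9SectBGpTransferInYR (ineq343_345_congr)
open B9SectBCodedChainOnSubfamilyR (gpFrame₂CodedOn)
open B9SectBStepPosFamilyTransfer (stepH2Pos_of_family_pos)
open B9GeoLemma21KLevelV1 (geo9Y_dist_triangle geo9Y_len_pos geo9Y_dist_comm)
open B9RWSums347DefiniteFacesWindow (geo9Y_dist_nonneg)
open B9GeoNormsKLevelModelSignsV1 (modelSignsOn_geo9K)
open Node00 (SiteY BlkY IBondY CfgY BallY SiteParY BondParY BondOpY liftY deltaPrimeAY kernelFamilyS GpY UboxY shiftY etaS cdS cdsS cdS_smul hqS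
  supBlkS' toKT)
open Node00.OpsYHolderFar (denS denS_nonneg pair_le_hqS hqS_le_of_forall hqS_nonneg)
open Node00.OpsYRead342 (geo9K_len_congr geo9K_dist_congr)
open Node00.OpsYRead342Cross (norm_cdsS_le_norm_cdS_symm_shift)
open B9Ineq349SiteComposite (cdSL cdsSL cdSL_apply cdsSL_apply etaS_pos)
open B9Ineq344LocalPairHolds (hqTP_mono_add)
open B9SectBH1ReadWriteY (wordS quotS h1ReadT quotS_nonneg quotS_liftY_le)
open B9SectBH1ProbesY (probeH probeH_apply norm_probeH quotS_wordS_eq Gsc symm_conj_apply symm_gradF_G symm_G_negGradB cutH_inl_nonneg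
  quotL_blockSupp_le norm_coordEquiv_symm_apply_le blockSupp_coordEquiv_liftY)
open B9SectBH1FrameCodedYR (KSC₅ KSC₅_h1_inl)
open B9SectBH1FrameCodedY (len_blkC_eq pow_level_mul_etaS_le_one)
open B9SectBE4FrameCodedYR (KSC₆ e4_read)
open B9SectBE4FrameCodedY (abs_apply_le_norm_symm norm_symm_gradF_G_negGradB norm_symm_negGradB_G_negGradB)
open B9SectBCodedReadingsUParH (KSCUPar)
open B9GeoNbrCountKLevelV1 (exists_card_nbr_geo9Y_le_of_M)

variable {d ℓ : ℕ} {hd : 1 ≤ d + 1} {hL : Odd (ℓ + 1) ∧ 1 < ℓ + 1} {b₀ b₁ : ℝ} {Mstar : ℕ}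
variable {𝔸 : Type} [NormedRing 𝔸] (P : RegExtraY d ℓ hd hL b₀ b₁ Mstar 𝔸) [NormedAlgebra ℂ 𝔸] [CompleteSpace 𝔸] [FiniteDimensional ℝ 𝔸]


/-! ## §1 Tool: the (3.45) block of the two-transporter reading READ at a pair -/

section Tools

variable [NormOneClass 𝔸] (c35 : ℝ) (G : Subgroup 𝔸ˣ) (x : MemberY d ℓ hd hL b₀ b₁ Mstar) (parA parH : SiteParY 𝔸 x.toKIdx) {ι : Type} [Fintype ι]
  (b : Module.Basis ι ℝ 𝔸) (ιB : BlkY x.toKIdx → IBondY x.toKIdx) [Fintype (geo9Y x).Site]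
  (C37 C38 : ℝ → CfgY 𝔸 x.toKIdx → AfldY 𝔸 x.toKIdx → Prop)

omit [FiniteDimensional ℝ 𝔸] [NormOneClass 𝔸] [Fintype (geo9Y x).Site] in
/-- ★ **THE (3.45) BLOCK OF THE TWO-TRANSPORTER READING `KSCUPar parA parH` AT A BASE, READ AT A PAIR** (operator `G′ = GpY parA`, quotients transported by `parH`): `quot_{z,z′}(ζ·∇_{U,μ}G′(U)∇*_{U,ν}(f ⊗ E)) ≦ B′₀(ε,β)·ℓ(y)^{−β}·(‖ζ‖_β + |ζ|)·e^{−δd(y,y′)}·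
(‖f‖_{β+ε} + |f|)` for `supp ζ ⊂ Δ(βy)`, `supp f ⊂ Δ(βy′)`, `‖E‖ ≦ 1`, `z ≠ z′` (the pair is below `hqS`, which is below its `⨆` — bounded over the ball by the basis).
[cite: Balaban1985BackgroundPropagators, (3.45) p.398, (3.40) p.397] -/
theorem h2_read_Par {M₂ : ℝ} (hM₂ : 0 ≤ M₂) (hrepr : ∀ (v : 𝔸) (j : ι), |b.repr v j| ≤ M₂ * ‖v‖)
    {Bεβ : ℝ → ℝ → ℝ} {δ : ℝ} {U : CfgY 𝔸 x.toKIdx} (hH2 : H2Block (KSCUPar P G x parA parH C37 C38) Bεβ δ (.base U))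
    {ε β' : ℝ} (hε0 : 0 < ε) (hε1 : ε ≤ 1) (hβ0 : 0 ≤ β') (hβ1 : β' < 1) (f : SiteY x.toKIdx → ℝ) (ζ : SiteY x.toKIdx → ℝ) (y y' : IBondY x.toKIdx)
    (hζ : (geo9Y x).cutInT (Sum.inl ζ) y) (hs : (geo9Y x).suppIn (Sum.inl f) y') (E : BallY 𝔸) (μ ν : Fin (d + 1)) {z z' : SiteY x.toKIdx} (hne : z ≠ z') :
    quotS x.toKIdx (parH U) β' (fun w => ((ζ w : ℝ) : ℂ) • cdS x.toKIdx U μ (GpY x.toKIdx parA U (cdsS x.toKIdx U ν (liftY f (E : 𝔸)))) w) z z' ≤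
      Bεβ ε β' * (geo9Y x).len y ^ (-β') * (geo9Y x).cutH β' (Sum.inl ζ) * Real.exp (-(δ * (geo9Y x).dist y y')) *
        ((geo9Y x).holder (β' + ε) (Sum.inl f) + (geo9Y x).supNorm (Sum.inl f)) := by
  have h := hH2 ε β' (Sum.inl f) (Sum.inl ζ) y y' hε0 hε1 hβ0 hβ1 hζ hs
  have hK : (KSCUPar P G x parA parH C37 C38).h2 (.base U) (.inl f) β' (.inl ζ) =
      ⨆ E' : BallY 𝔸, ⨆ μ' : Fin (d + 1), ⨆ ν' : Fin (d + 1), hqS x.toKIdx (parH U) β'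
        (fun w => ((ζ w : ℝ) : ℂ) • cdS x.toKIdx U μ' (GpY x.toKIdx parA U (cdsS x.toKIdx U ν' (liftY f (E' : 𝔸)))) w) := rfl
  rw [hK] at h
  refine le_trans ?_ h
  set T : (SiteY x.toKIdx → 𝔸) →ₗ[ℂ] (SiteY x.toKIdx → 𝔸) := GpY x.toKIdx parA U with hT
  -- every integrand is the `wordS` of `W2`; bounded over the unit ball
  have hw : ∀ (E' : 𝔸) (μ' ν' : Fin (d + 1)), (fun w => ((ζ w : ℝ) : ℂ) • cdS x.toKIdx U μ' (T (cdsS x.toKIdx U ν' (liftY f E'))) w) =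
      wordS x.toKIdx ζ (W2 x T U μ' ν') (liftY f E') := fun E' μ' ν' => h2word_eq x T U μ' ν' ζ _
  have hbdd : BddAbove (Set.range fun E' : BallY 𝔸 => ⨆ μ' : Fin (d + 1), ⨆ ν' : Fin (d + 1), hqS x.toKIdx (parH U) β'
      (fun w => ((ζ w : ℝ) : ℂ) • cdS x.toKIdx U μ' (T (cdsS x.toKIdx U ν' (liftY f (E' : 𝔸)))) w)) := by
    refine ⟨∑ μ', ∑ ν', M₂ * ∑ j, hqS x.toKIdx (parH U) β' (wordS x.toKIdx ζ (W2 x T U μ' ν') (liftY f (b j))), ?_⟩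
    rintro _ ⟨E', rfl⟩
    have hnn : ∀ μ' ν', 0 ≤ M₂ * ∑ j, hqS x.toKIdx (parH U) β' (wordS x.toKIdx ζ (W2 x T U μ' ν') (liftY f (b j))) := fun μ' ν' =>
      mul_nonneg hM₂ (Finset.sum_nonneg fun j _ => hqS_nonneg x.toKIdx _ β' _)
    have hS : 0 ≤ ∑ μ', ∑ ν', M₂ * ∑ j, hqS x.toKIdx (parH U) β' (wordS x.toKIdx ζ (W2 x T U μ' ν') (liftY f (b j))) :=
      Finset.sum_nonneg fun μ' _ => Finset.sum_nonneg fun ν' _ => hnn μ' ν'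
    refine Real.iSup_le (fun μ' => Real.iSup_le (fun ν' => ?_) hS) hS
    rw [hw]
    refine (hqS_wordS_liftY_le x b (W2 x T U μ' ν') (parH U) β' ζ hM₂ hrepr f (mem_closedBall_zero_iff.1 E'.2)).trans ?_
    refine le_trans ?_ (Finset.single_le_sum (f := fun μ'' => ∑ ν', M₂ * ∑ j, hqS x.toKIdx (parH U) β' (wordS x.toKIdx ζ (W2 x T U μ'' ν') (liftY f (b j))))
      (fun μ'' _ => Finset.sum_nonneg fun ν' _ => hnn μ'' ν') (Finset.mem_univ μ'))
    exact Finset.single_le_sum (f := fun ν'' => M₂ * ∑ j, hqS x.toKIdx (parH U) β' (wordS x.toKIdx ζ (W2 x T U μ' ν'') (liftY f (b j))))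
      (fun ν'' _ => hnn μ' ν'') (Finset.mem_univ ν')
  refine le_trans ?_ (le_ciSup hbdd E)
  refine le_trans ?_ (le_ciSup (f := fun μ' : Fin (d + 1) => ⨆ ν' : Fin (d + 1), hqS x.toKIdx (parH U) β'
    (fun w => ((ζ w : ℝ) : ℂ) • cdS x.toKIdx U μ' (T (cdsS x.toKIdx U ν' (liftY f (E : 𝔸)))) w)) (Finite.bddAbove_range _) μ)
  refine le_trans ?_ (le_ciSup (f := fun ν' : Fin (d + 1) => hqS x.toKIdx (parH U) β'
    (fun w => ((ζ w : ℝ) : ℂ) • cdS x.toKIdx U μ (T (cdsS x.toKIdx U ν' (liftY f (E : 𝔸)))) w)) (Finite.bddAbove_range _) ν)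
  exact pair_le_hqS x.toKIdx (parH U) β' (fun w => ((ζ w : ℝ) : ℂ) • cdS x.toKIdx U μ (T (cdsS x.toKIdx U ν (liftY f (E : 𝔸)))) w) hne

end Tools

/-! ## §2 ★★ The transfer field of the (3.45) frame PROVED for `KSC₇Par parA parH` -/

section Transfer

variable [NormOneClass 𝔸] (c35 : ℝ) (G : Subgroup 𝔸ˣ) (x : MemberY d ℓ hd hL b₀ b₁ Mstar) (parA parH : SiteParY 𝔸 x.toKIdx) {ι : Type} [Fintype ι]
  (b : Module.Basis ι ℝ 𝔸) (ιB : BlkY x.toKIdx → IBondY x.toKIdx) [Fintype (geo9Y x).Site]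
  (C37 C38 : ℝ → CfgY 𝔸 x.toKIdx → AfldY 𝔸 x.toKIdx → Prop)

set_option maxHeartbeats 1600000 in
/-- ★★ **THE TRANSFER FIELD OF THE (3.45) FRAME, PROVED FOR THE TWO-TRANSPORTER FAMILY `KSC₇Par parA parH`** (dag-n06-c g12's proof of
`B9SectBH2FrameCodedY.h2_transfer_KSC₇` re-threaded with the printed transporter roles SEPARATED: operator letters `GopC ∕ GpY` at the AVERAGING transporter `parA`
((3.21) p.394), Hölder probes `probeH ∕ hqS ∕ quotS ∕ h1ReadT` at the HÖLDER transporter `parH` ((3.40) p.397); NO law of `parH` is needed): from r06's per-probe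
transfer (vi′) for the letters of the member (hypothesis `HVI`, letters at `parA`), the (3.42) majorants at the base (`hread`), the Hölder block (3.43)–(3.45) of
`KSC₇Par` at the base (= `KSCUPar`'s) and unit norms of the bond variables (`G`-valued base): the (3.45) block of `KSC₇Par` at the coded product with
`(wH2₇ … B δc Bβ Bε Bεβ, 4δc∕5)`.
[cite: Balaban1985BackgroundPropagators, Thm 3.4 p.400, (3.43)–(3.45) p.398, (3.40) p.397, p.403 l.2–7, (3.3) p.390, (3.8) p.392; Balaban1984PropagatorsII, (2.51)–(2.52) p.232, (2.54) p.233] -/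
theorem h2_transfer_KSC₇Par (hι : ∀ s : BlkY x.toKIdx, β x.toKIdx.hN x.toKIdx.D x.toKIdx.hk (ιB s) = s)
    (hG1 : ∀ u : 𝔸ˣ, u ∈ G → ‖(u : 𝔸)‖ ≤ 1)
    {M₂ : ℝ} (hM₂ : 0 ≤ M₂) (hrepr : ∀ (v : 𝔸) (j : ι), |b.repr v j| ≤ M₂ * ‖v‖)
    {MInv cR aInv aW : ℝ} (hcR : 0 < cR) (hread : Read342Y P G x parA b ιB C37 C38 (KSC₇Par P G x parA parH C37 C38) c35 cR MInv aInv 0 True)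
    (α₀ : ℝ) (c c' : (codingYx P G x C37 C38).bg.Cfg) (α₁ B₀ B δ δc : ℝ) (Bβ Bε : ℝ → ℝ) (Bεβ : ℝ → ℝ → ℝ)
    (hM : MInv ≤ (geo9Y x).M) (hα₀ : 0 < α₀) (hMa : (geo9Y x).M * α₀ ≤ aInv) (hreg : (codingYx P G x C37 C38).bg.Reg335 c35 α₀ c)
    (_hα₁ : 0 < α₁) (_haW : α₁ ≤ aW) (h37 : (codingYx P G x C37 C38).bg.Cplx337 α₁ c c') (hB₀ : 0 < B₀) (hB : 0 ≤ B)
    (hδ : 0 < δ) (hδc : 0 < δc) (hδcδ : δc ≤ δ)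
    (hE : EBlock (KSC₇Par P G x parA parH C37 C38) B₀ δ c) (hHol : B9.Ineq343_345 (KSC₇Par P G x parA parH C37 C38) Bβ Bε Bεβ δ c)
    (HVI : ∀ (Dl Ds : Module.End ℝ (SiteY x.toKIdx × ι → ℝ)),
      HasMajorant (g := toB6 (geo9Y x) (0 : ℝ) True) (fun p : SiteY x.toKIdx × ι => blkC x.toKIdx ιB p.1) (Dl * GopC x.toKIdx parA b c)
        (fun a a' => cR * B₀ * (geo9Y x).len a * Real.exp (-(δc * (geo9Y x).dist a a'))) →
      HasMajorant (g := toB6 (geo9Y x) (0 : ℝ) True) (fun p : SiteY x.toKIdx × ι => blkC x.toKIdx ιB p.1) (GopC x.toKIdx parA b c * Ds)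
        (fun a a' => cR * B₀ * (geo9Y x).len a * Real.exp (-(δc * (geo9Y x).dist a a'))) →
      ∀ (Φ : (SiteY x.toKIdx → 𝔸) →ₗ[ℝ] 𝔸) (y : IBondY x.toKIdx) (p₀ : SiteY x.toKIdx × ι), blkC x.toKIdx ιB p₀.1 = y →
      ∀ (γ Bh cζ : ℝ), 0 ≤ Bh → 0 ≤ cζ →
        (∀ (y'' : IBondY x.toKIdx) (ν : SiteY x.toKIdx × ι → ℝ) (C : ℝ),
          BlockSupp (g := toB6 (geo9Y x) (0 : ℝ) True) (fun p : SiteY x.toKIdx × ι => blkC x.toKIdx ιB p.1) ν y'' C →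
          ‖Φ ((coordEquiv b).symm (Dl (GopC x.toKIdx parA b c ν)))‖ ≤
            Bh * (geo9Y x).len y ^ (1 - γ) * cζ * Real.exp (-(δc * (geo9Y x).dist y y'')) * C) →
      ∀ (y' : IBondY x.toKIdx) (μ : SiteY x.toKIdx × ι → ℝ) (M : ℝ),
        BlockSupp (g := toB6 (geo9Y x) (0 : ℝ) True) (fun p : SiteY x.toKIdx × ι => blkC x.toKIdx ιB p.1) μ y' M →
      ∀ (N : ℝ), 0 ≤ N →
        (∀ (k : Fin (d + 1) ⊕ Fin (d + 1)) (z : SiteY x.toKIdx × ι),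
          |(((conj b (diffLetter (shiftY x.toKIdx) (coordC G x.toKIdx c) ((((geo9Y x).eta : ℂ))⁻¹) k)) * GopC x.toKIdx parA b c * Ds) μ) z| ≤
            N * Real.exp (-(δc * (geo9Y x).dist (blkC x.toKIdx ιB z.1) y'))) →
      ∀ (N₂ : ℝ), 0 ≤ N₂ →
        ‖Φ ((coordEquiv b).symm ((Dl * GopC x.toKIdx parA b c * Ds) μ))‖ ≤ N₂ * Real.exp (-(δc * (geo9Y x).dist y y')) →
        ‖Φ ((coordEquiv b).symm ((Dl * GopC x.toKIdx parA b ((codingYx P G x C37 C38).bg.mul c' c) * Ds) μ))‖ ≤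
          B * (N₂ + Bh * (geo9Y x).len y ^ (1 - γ) * cζ * ((geo9Y x).len y)⁻¹ * (N + M)) *
            Real.exp (-(4 / 5 * δc * (geo9Y x).dist y y'))) :
    H2Block (KSC₇Par P G x parA parH C37 C38) (wH2₇ (2 * ((d : ℝ) + 1)) (∑ j, ‖b j‖) M₂ B δc Bβ Bε Bεβ) (4 / 5 * δc)
      ((codingYx P G x C37 C38).bg.mul c' c) := by
  classical
  letI : Fintype (B9GeoNormsKLevelV1.geo9K x.toKIdx).Site := ‹Fintype (geo9Y x).Site›
  obtain ⟨U, a, rfl, rfl, hCa⟩ := (codingYx P G x C37 C38).exists_of_bg_Cplx337 h37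
  have hU335 : (bg9YC 𝔸 G P x).Reg335 c35 α₀ U := by
    obtain ⟨U', h1, h2⟩ := (codingYx P G x C37 C38).exists_of_bg_Reg335 hreg
    cases h1
    exact h2
  have hU : GVal G x.toKIdx U := hU335.1.1
  set Sb : ℝ := ∑ j, ‖b j‖ with hSb
  have hSb0 : 0 ≤ Sb := Finset.sum_nonneg fun j _ => norm_nonneg _
  set TU : (SiteY x.toKIdx → 𝔸) →ₗ[ℂ] (SiteY x.toKIdx → 𝔸) := GpY x.toKIdx parA U with hTU
  set TW : (SiteY x.toKIdx → 𝔸) →ₗ[ℂ] (SiteY x.toKIdx → 𝔸) := GpY x.toKIdx parA (decY x.toKIdx (.prod U a)) with hTW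
  have hη : 0 < etaS x.toKIdx := etaS_pos x.toKIdx
  have hco : coordC G x.toKIdx (.base U) = UboxY x.toKIdx U := (letters_base_of_gVal G x.toKIdx parA hU).1
  have hGopU : GopC x.toKIdx parA b (.base U) = conj b (Gsc x.toKIdx TU) := by
    show conj b (((kGeo x.toKIdx).eta ^ 2) • (GpY x.toKIdx parA U).restrictScalars ℝ) = conj b ((etaS x.toKIdx ^ 2) • TU.restrictScalars ℝ)
    rw [etaS_eq_eta]
  have hGopW : GopC x.toKIdx parA b ((codingYx P G x C37 C38).bg.mul (.mult a) (.base U)) = conj b (Gsc x.toKIdx TW) := by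
    show conj b (((kGeo x.toKIdx).eta ^ 2) • (GpY x.toKIdx parA (decY x.toKIdx (.prod U a))).restrictScalars ℝ) =
      conj b ((etaS x.toKIdx ^ 2) • TW.restrictScalars ℝ)
    rw [etaS_eq_eta]
  have hDk : ∀ k : Fin (d + 1) ⊕ Fin (d + 1),
      diffLetter (shiftY x.toKIdx) (coordC G x.toKIdx (.base U)) ((((geo9Y x).eta : ℂ))⁻¹) k =
        diffLetter (shiftY x.toKIdx) (UboxY x.toKIdx U) ((((etaS x.toKIdx : ℝ) : ℂ))⁻¹) k := by
    intro k
    show diffLetter (shiftY x.toKIdx) (coordC G x.toKIdx (.base U)) ((((kGeo x.toKIdx).eta : ℝ) : ℂ))⁻¹ k = _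
    rw [hco, etaS_eq_eta]
  have hUu : ∀ (μ : Fin (d + 1)) (w : SiteY x.toKIdx), ‖((UboxY x.toKIdx U μ w : 𝔸ˣ) : 𝔸)‖ ≤ 1 ∧ ‖(((UboxY x.toKIdx U μ w)⁻¹ : 𝔸ˣ) : 𝔸)‖ ≤ 1 :=
    fun μ w => norm_le_one_and_inv_of_mem G hG1 (hU μ _)
  have hdd : 0 ≤ 2 * ((d : ℝ) + 1) := by positivity
  -- the (3.42) majorants of the letters at the base
  obtain ⟨-, hm1, hm2, -⟩ := hread α₀ U B₀ δ hM hα₀ hMa hU335 hB₀ hδ hE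
  have hlow : ∀ a a' : IBondY x.toKIdx, cR * B₀ * (geo9Y x).len a * Real.exp (-(δ * (geo9Y x).dist a a')) ≤
      cR * B₀ * (geo9Y x).len a * Real.exp (-(δc * (geo9Y x).dist a a')) := fun a a' =>
    mul_le_mul_of_nonneg_left (Real.exp_le_exp.2 (by nlinarith [geo9Y_dist_nonneg x a a'])) (mul_nonneg (mul_pos hcR hB₀).le (geo9Y_len_pos x a).le)
  -- the three Hölder∕input blocks at the base, in U-letters
  obtain ⟨hH1, hE4, hH2⟩ := hHol
  have hH1' : H1Block (KSCUPar P G x parA parH C37 C38) Bβ δ (.base U) := (h1Block_KSC₇Par_iff P G x parA parH C37 C38 _).1 hH1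
  have hE4' : E4Block (KSCU P G x parA C37 C38) Bε δ (.base U) :=
    (e4Block_KSCUPar_iff P G x parA parH C37 C38 _).1 ((e4Block_KSC₇Par_iff P G x parA parH C37 C38 _).1 hE4)
  have hH2' : H2Block (KSCUPar P G x parA parH C37 C38) Bεβ δ (.base U) := (h2Block_KSC₇Par_iff P G x parA parH C37 C38 _).1 hH2
  -- the output block
  intro ε β' lam ζ y y' hε0 hε1 hβ0 hβ1 hζ hlam
  have hW : 0 ≤ wH2₇ (2 * ((d : ℝ) + 1)) Sb M₂ B δc Bβ Bε Bεβ ε β' := wH2₇_nonneg Bβ Bε Bεβ hSb0 hB hM₂ ε β'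
  have hleny : 0 < (geo9Y x).len y := geo9Y_len_pos x y
  have hcutH : 0 ≤ (geo9Y x).cutH β' ζ := (modelSignsOn_geo9K x.toKIdx).cutH_nonneg β' ζ
  have hHS : 0 ≤ (geo9Y x).holder (β' + ε) lam + (geo9Y x).supNorm lam :=
    add_nonneg ((modelSignsOn_geo9K x.toKIdx).holder_nonneg _ lam) ((modelSignsOn_geo9K x.toKIdx).supNorm_nonneg lam)
  have hRHS : 0 ≤ wH2₇ (2 * ((d : ℝ) + 1)) Sb M₂ B δc Bβ Bε Bεβ ε β' * (geo9Y x).len y ^ (-β') * (geo9Y x).cutH β' ζ *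
      Real.exp (-(4 / 5 * δc * (geo9Y x).dist y y')) * ((geo9Y x).holder (β' + ε) lam + (geo9Y x).supNorm lam) :=
    mul_nonneg (mul_nonneg (mul_nonneg (mul_nonneg hW (Real.rpow_nonneg hleny.le _)) hcutH) (Real.exp_pos _).le) hHS
  rcases lam with f | J
  swap
  · rw [(KSC₇Par_h2_off P G x parA parH C37 C38 _ β').2 J ζ]; exact hRHS
  rcases ζ with ζ₀ | zb
  swap
  · rw [(KSC₇Par_h2_off P G x parA parH C37 C38 _ β').1 f zb]; exact hRHS
  have hlam' : (geo9Y x).suppIn (Sum.inl f) y' := hlam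
  have hζ' : ∀ w, ζ₀ w ≠ 0 → blkY x.toKIdx w = β x.toKIdx.hN x.toKIdx.D x.toKIdx.hk y := hζ
  have hsupN : 0 ≤ (geo9Y x).supNorm (Sum.inl f) := (modelSignsOn_geo9K x.toKIdx).supNorm_nonneg _
  have hholε : 0 ≤ (geo9Y x).holder ε (Sum.inl f) := (modelSignsOn_geo9K x.toKIdx).holder_nonneg ε _
  have hhol : 0 ≤ (geo9Y x).holder (β' + ε) (Sum.inl f) := (modelSignsOn_geo9K x.toKIdx).holder_nonneg _ _
  -- `‖f‖_ε ≦ ‖f‖_{β+ε} + 2|f|`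
  have hholmono : (geo9Y x).holder ε (Sum.inl f) ≤ (geo9Y x).holder (β' + ε) (Sum.inl f) + 2 * (geo9Y x).supNorm (Sum.inl f) := by
    show hqTP (toKT x.toKIdx) ε f ≤ hqTP (toKT x.toKIdx) (β' + ε) f + 2 * (toKT x.toKIdx).supF f
    exact hqTP_mono_add x.toKIdx hε0 (by linarith) f
  -- the (3.45) member of the reading at the product: a ⨆ of `hqS`
  rw [KSC₇Par_h2_inl]
  show (⨆ E : BallY 𝔸, ⨆ μ : Fin (d + 1), ⨆ ν : Fin (d + 1), hqS x.toKIdx (parH U) β'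
    (fun w => ((ζ₀ w : ℝ) : ℂ) • cdS x.toKIdx U μ (TW (cdsS x.toKIdx U ν (liftY f (E : 𝔸)))) w)) ≤ _
  refine Real.iSup_le (fun E => Real.iSup_le (fun μ => Real.iSup_le (fun ν => hqS_le_of_forall x.toKIdx (parH U) β' _ hRHS
    fun z z' hne => ?_) hRHS) hRHS) hRHS
  have hE1 : ‖(E : 𝔸)‖ ≤ 1 := mem_closedBall_zero_iff.1 E.2
  set X : SiteY x.toKIdx → 𝔸 := cdS x.toKIdx U μ (TW (cdsS x.toKIdx U ν (liftY f (E : 𝔸)))) with hX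
  -- the pair quotient is the norm of the probe
  have hquot : ‖B9Eq39Adjoint.R (parH U z z') ((((ζ₀ z' : ℝ) : ℂ)) • X z') - (((ζ₀ z : ℝ) : ℂ)) • X z‖ / denS x.toKIdx β' z z' =
      ‖probeH x.toKIdx (parH U) β' ζ₀ z z' X‖ := by rw [norm_probeH]; rfl
  rw [hquot]
  -- trivial cut-off
  by_cases hζ0 : ∀ w, ζ₀ w = 0
  · rw [probeH_apply]
    simp only [hζ0, Complex.ofReal_zero, zero_smul, B9Eq39Adjoint.R_zero, sub_zero, smul_zero, norm_zero]
    exact hRHS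
  push Not at hζ0
  obtain ⟨w₀, hw₀⟩ := hζ0
  -- the anchor
  set y₁ : IBondY x.toKIdx := blkC x.toKIdx ιB w₀ with hy₁
  have hy₁β : β x.toKIdx.hN x.toKIdx.D x.toKIdx.hk y₁ = β x.toKIdx.hN x.toKIdx.D x.toKIdx.hk y := by
    show β x.toKIdx.hN x.toKIdx.D x.toKIdx.hk (ιB (blkY x.toKIdx w₀)) = _; rw [hι, hζ' w₀ hw₀]
  have hlen : (geo9Y x).len y₁ = (geo9Y x).len y := geo9K_len_congr x.toKIdx hy₁β
  have hdist : ∀ t : IBondY x.toKIdx, (geo9Y x).dist y₁ t = (geo9Y x).dist y t := fun t => geo9K_dist_congr x.toKIdx hy₁β rfl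
  set yL : IBondY x.toKIdx := ιB (β x.toKIdx.hN x.toKIdx.D x.toKIdx.hk y') with hyL
  have hyLβ : β x.toKIdx.hN x.toKIdx.D x.toKIdx.hk yL = β x.toKIdx.hN x.toKIdx.D x.toKIdx.hk y' := hι _
  have hdistL : (geo9Y x).dist y₁ yL = (geo9Y x).dist y y' := geo9K_dist_congr x.toKIdx hy₁β (hι _)
  have hlamL : (geo9Y x).suppIn (Sum.inl f) yL := by
    intro w hw; show B6Geom246MultiLevelBox.blkOf x.toKIdx.D.toDomains w = β x.toKIdx.hN x.toKIdx.D x.toKIdx.hk yL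
    rw [hyLβ]; exact hlam' w hw
  have hleny₁ : 0 < (geo9Y x).len y₁ := geo9Y_len_pos x y₁
  haveI : Nontrivial 𝔸 := NormOneClass.nontrivial
  obtain ⟨j₀⟩ := b.index_nonempty
  have hp₀ : blkC x.toKIdx ιB ((w₀, j₀) : SiteY x.toKIdx × ι).1 = y₁ := rfl
  set cζ : ℝ := (geo9Y x).cutH β' (Sum.inl ζ₀) with hcζ
  have hcζ0 : 0 ≤ cζ := hcutH
  set Bp : ℝ := max (Bβ β') 0 with hBp
  have hBp0 : 0 ≤ Bp := le_max_right _ _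
  set Bpe : ℝ := max (Bε ε) 0 with hBpe
  have hBpe0 : 0 ≤ Bpe := le_max_right _ _
  set Bp2 : ℝ := max (Bεβ ε β') 0 with hBp2
  have hBp20 : 0 ≤ Bp2 := le_max_right _ _
  set BhL : ℝ := Sb * Bp with hBhL
  have hBhL0 : 0 ≤ BhL := mul_nonneg hSb0 hBp0
  -- the letters of the output word, the probe, the input
  set Dl : Module.End ℝ (SiteY x.toKIdx × ι → ℝ) := conj b (gradLetterF (shiftY x.toKIdx) (UboxY x.toKIdx U) ((((etaS x.toKIdx : ℝ) : ℂ))⁻¹) μ) with hDl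
  set Ds : Module.End ℝ (SiteY x.toKIdx × ι → ℝ) :=
    conj b (diffLetter (shiftY x.toKIdx) (coordC G x.toKIdx (.base U)) ((((geo9Y x).eta : ℂ))⁻¹) (Sum.inr ν)) with hDs
  have hDsU : Ds = conj b (-gradLetterB (shiftY x.toKIdx) (UboxY x.toKIdx U) ((((etaS x.toKIdx : ℝ) : ℂ))⁻¹) ν) := by rw [hDs, hDk, diffLetter_inr]
  have hDlU : Dl = conj b (diffLetter (shiftY x.toKIdx) (coordC G x.toKIdx (.base U)) ((((geo9Y x).eta : ℂ))⁻¹) (Sum.inl μ)) := by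
    rw [hDl, hDk, diffLetter_inl]
  set Φ : (SiteY x.toKIdx → 𝔸) →ₗ[ℝ] 𝔸 := probeH x.toKIdx (parH U) β' ζ₀ z z' with hΦ
  have hmajL : HasMajorant (g := toB6 (geo9Y x) (0 : ℝ) True) (fun p : SiteY x.toKIdx × ι => blkC x.toKIdx ιB p.1) (Dl * GopC x.toKIdx parA b (.base U))
      (fun a a' => cR * B₀ * (geo9Y x).len a * Real.exp (-(δc * (geo9Y x).dist a a'))) := by
    rw [hDlU]; exact hasMajorant_mono _ (hm1 (Sum.inl μ)) hlow
  have hmajR : HasMajorant (g := toB6 (geo9Y x) (0 : ℝ) True) (fun p : SiteY x.toKIdx × ι => blkC x.toKIdx ιB p.1) (GopC x.toKIdx parA b (.base U) * Ds)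
      (fun a a' => cR * B₀ * (geo9Y x).len a * Real.exp (-(δc * (geo9Y x).dist a a'))) :=
    hasMajorant_mono _ (hm2 (Sum.inr ν)) hlow
  have hBS : BlockSupp (g := toB6 (geo9Y x) (0 : ℝ) True) (fun p : SiteY x.toKIdx × ι => blkC x.toKIdx ιB p.1)
      (coordEquiv b (liftY f (E : 𝔸))) yL (M₂ * (geo9Y x).supNorm (Sum.inl f)) :=
    blockSupp_coordEquiv_liftY x.toKIdx b ιB hM₂ hrepr f y' hlam' hE1
  have hliftE : (coordEquiv b).symm (coordEquiv b (liftY f (E : 𝔸))) = liftY f (E : 𝔸) := LinearEquiv.symm_apply_apply _ _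
  -- (A) the LEFT Hölder probes of `D_l·G′(U)` at block-supported inputs, from the (3.43) block at the base
  set Wf : IBondY x.toKIdx → ℝ := fun a' => Bp * (geo9Y x).len y₁ ^ (1 - β') * cζ * Real.exp (-(δc * (geo9Y x).dist y₁ a')) with hWf
  have hWf0 : ∀ a', 0 ≤ Wf a' := fun a' =>
    mul_nonneg (mul_nonneg (mul_nonneg hBp0 (Real.rpow_nonneg hleny₁.le _)) hcζ0) (Real.exp_pos _).le
  have hreadU : ∀ (g : SiteY x.toKIdx → ℝ) (a' : IBondY x.toKIdx), (geo9Y x).suppIn (Sum.inl g) a' →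
      h1ReadT x.toKIdx TU (parH U) U g β' ζ₀ ≤ Wf a' * (geo9Y x).supNorm (Sum.inl g) := by
    intro g a' hg
    have h := hH1' β' (Sum.inl g) (Sum.inl ζ₀) y a' hβ0 hβ1 hζ hg
    rw [B9SectBCodedReadingsUParH.KSCUPar_h1_inl] at h
    have hN : 0 ≤ (geo9Y x).supNorm (Sum.inl g) := (modelSignsOn_geo9K x.toKIdx).supNorm_nonneg _
    refine (show h1ReadT x.toKIdx TU (parH U) U g β' ζ₀ ≤ _ from h).trans ?_
    rw [← hlen, ← hdist]
    have hP : 0 ≤ (geo9Y x).len y₁ ^ (1 - β') * cζ := mul_nonneg (Real.rpow_nonneg hleny₁.le _) hcζ0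
    have hexp : Real.exp (-(δ * (geo9Y x).dist y₁ a')) ≤ Real.exp (-(δc * (geo9Y x).dist y₁ a')) :=
      Real.exp_le_exp.2 (by nlinarith [geo9Y_dist_nonneg x y₁ a'])
    calc Bβ β' * (geo9Y x).len y₁ ^ (1 - β') * (geo9Y x).cutH β' (Sum.inl ζ₀) * Real.exp (-(δ * (geo9Y x).dist y₁ a')) *
          (geo9Y x).supNorm (Sum.inl g)
        = Bβ β' * (((geo9Y x).len y₁ ^ (1 - β') * cζ) * Real.exp (-(δ * (geo9Y x).dist y₁ a')) * (geo9Y x).supNorm (Sum.inl g)) := by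
          rw [hcζ]; ring
      _ ≤ Bp * (((geo9Y x).len y₁ ^ (1 - β') * cζ) * Real.exp (-(δc * (geo9Y x).dist y₁ a')) * (geo9Y x).supNorm (Sum.inl g)) := by
          refine mul_le_mul (le_max_left _ _) ?_ (mul_nonneg (mul_nonneg hP (Real.exp_pos _).le) hN) hBp0
          exact mul_le_mul_of_nonneg_right (mul_le_mul_of_nonneg_left hexp hP) hN
      _ = Wf a' * (geo9Y x).supNorm (Sum.inl g) := by rw [hWf]; ring
  have premA : ∀ (y'' : IBondY x.toKIdx) (νv : SiteY x.toKIdx × ι → ℝ) (C : ℝ),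
      BlockSupp (g := toB6 (geo9Y x) (0 : ℝ) True) (fun p : SiteY x.toKIdx × ι => blkC x.toKIdx ιB p.1) νv y'' C →
      ‖Φ ((coordEquiv b).symm (Dl (GopC x.toKIdx parA b (.base U) νv)))‖ ≤
        BhL * (geo9Y x).len y₁ ^ (1 - β') * cζ * Real.exp (-(δc * (geo9Y x).dist y₁ y'')) * C := by
    intro y'' νv C hν
    calc ‖Φ ((coordEquiv b).symm (Dl (GopC x.toKIdx parA b (.base U) νv)))‖
        = quotS x.toKIdx (parH U) β' (wordS x.toKIdx ζ₀ (cdSL x.toKIdx U μ ∘ₗ TU) ((coordEquiv b).symm νv)) z z' := by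
          rw [quotS_wordS_eq, hGopU, ← Module.End.mul_apply, hDl, symm_gradF_G]; rfl
      _ ≤ Sb * (Wf y'' * C) := quotL_blockSupp_le x.toKIdx b ιB TU (parH U) U hι hM₂ hrepr β' ζ₀ hWf0 hreadU hν μ hne
      _ = BhL * (geo9Y x).len y₁ ^ (1 - β') * cζ * Real.exp (-(δc * (geo9Y x).dist y₁ y'')) * C := by rw [hWf, hBhL]; ring
  -- (N) the sup data of `∇♯_k·G′(U)·D_s` at the input, from the (3.44) block at the base
  have he4U : ∀ (μ' ν' : Fin (d + 1)) (w : SiteY x.toKIdx),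
      ‖cdS x.toKIdx U μ' (TU (cdsS x.toKIdx U ν' (liftY f (E : 𝔸)))) w‖ ≤
        Bpe * Real.exp (-(δc * (geo9Y x).dist (blkC x.toKIdx ιB w) yL)) * ((geo9Y x).holder ε (Sum.inl f) + (geo9Y x).supNorm (Sum.inl f)) := by
    intro μ' ν' w
    have hwb : blkY x.toKIdx w = β x.toKIdx.hN x.toKIdx.D x.toKIdx.hk (blkC x.toKIdx ιB w) := (hι _).symm
    refine (e4_read P G x parA C37 C38 hE4' hε0 hε1 f (blkC x.toKIdx ιB w) yL hlamL E μ' ν' hwb).trans ?_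
    have hHS' : 0 ≤ (geo9Y x).holder ε (Sum.inl f) + (geo9Y x).supNorm (Sum.inl f) := add_nonneg hholε hsupN
    refine mul_le_mul_of_nonneg_right ?_ hHS'
    have hexp : Real.exp (-(δ * (geo9Y x).dist (blkC x.toKIdx ιB w) yL)) ≤ Real.exp (-(δc * (geo9Y x).dist (blkC x.toKIdx ιB w) yL)) :=
      Real.exp_le_exp.2 (by nlinarith [geo9Y_dist_nonneg x (blkC x.toKIdx ιB w) yL])
    calc Bε ε * Real.exp (-(δ * (geo9Y x).dist (blkC x.toKIdx ιB w) yL))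
        ≤ Bpe * Real.exp (-(δ * (geo9Y x).dist (blkC x.toKIdx ιB w) yL)) := mul_le_mul_of_nonneg_right (le_max_left _ _) (Real.exp_pos _).le
      _ ≤ Bpe * Real.exp (-(δc * (geo9Y x).dist (blkC x.toKIdx ιB w) yL)) := mul_le_mul_of_nonneg_left hexp hBpe0
  have he4U' : ∀ (μ' ν' : Fin (d + 1)) (w : SiteY x.toKIdx),
      ‖cdsS x.toKIdx U μ' (TU (cdsS x.toKIdx U ν' (liftY f (E : 𝔸)))) w‖ ≤
        Bpe * Real.exp (δc * (2 * ((d : ℝ) + 1))) * Real.exp (-(δc * (geo9Y x).dist (blkC x.toKIdx ιB w) yL)) *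
          ((geo9Y x).holder ε (Sum.inl f) + (geo9Y x).supNorm (Sum.inl f)) := by
    intro μ' ν' w
    refine (norm_cdsS_le_norm_cdS_symm_shift x.toKIdx U hUu μ' _ w).trans ((he4U μ' ν' _).trans ?_)
    have hHS' : 0 ≤ (geo9Y x).holder ε (Sum.inl f) + (geo9Y x).supNorm (Sum.inl f) := add_nonneg hholε hsupN
    refine mul_le_mul_of_nonneg_right ?_ hHS'
    rw [mul_assoc]
    refine mul_le_mul_of_nonneg_left ?_ hBpe0
    rw [← Real.exp_add]
    refine Real.exp_le_exp.2 ?_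
    have hst := stencilB_blkC x.toKIdx ιB hι μ' w
    have htri := geo9Y_dist_triangle x (blkC x.toKIdx ιB w) (blkC x.toKIdx ιB ((shiftY x.toKIdx μ').symm w)) yL
    have h3 : (geo9Y x).dist (blkC x.toKIdx ιB w) yL ≤ 2 * ((d : ℝ) + 1) + (geo9Y x).dist (blkC x.toKIdx ιB ((shiftY x.toKIdx μ').symm w)) yL := by
      have hst' : (geo9Y x).dist (blkC x.toKIdx ιB w) (blkC x.toKIdx ιB ((shiftY x.toKIdx μ').symm w)) ≤ 2 * ((d : ℝ) + 1) := hst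
      linarith
    have h4 := mul_le_mul_of_nonneg_left h3 hδc.le
    rw [mul_add] at h4
    linarith
  set N : ℝ := M₂ * (Bpe * Real.exp (δc * (2 * ((d : ℝ) + 1))) * ((geo9Y x).holder ε (Sum.inl f) + (geo9Y x).supNorm (Sum.inl f))) with hN
  have hN0 : 0 ≤ N := by positivity
  have hN1 : ∀ (k : Fin (d + 1) ⊕ Fin (d + 1)) (zz : SiteY x.toKIdx × ι),
      |(((conj b (diffLetter (shiftY x.toKIdx) (coordC G x.toKIdx (.base U)) ((((geo9Y x).eta : ℂ))⁻¹) k)) * GopC x.toKIdx parA b (.base U) * Ds)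
        (coordEquiv b (liftY f (E : 𝔸)))) zz| ≤ N * Real.exp (-(δc * (geo9Y x).dist (blkC x.toKIdx ιB zz.1) yL)) := by
    intro k zz
    refine (abs_apply_le_norm_symm x b hrepr _ zz).trans ?_
    rw [hDk, hGopU, hDsU]
    rcases k with μ' | μ'
    · rw [diffLetter_inl, norm_symm_gradF_G_negGradB x b TU U μ' ν _ zz.1, hliftE]
      refine (mul_le_mul_of_nonneg_left (he4U μ' ν zz.1) hM₂).trans ?_
      rw [hN]
      have hone : (1 : ℝ) ≤ Real.exp (δc * (2 * ((d : ℝ) + 1))) := Real.one_le_exp (by positivity)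
      have hHS' : 0 ≤ (geo9Y x).holder ε (Sum.inl f) + (geo9Y x).supNorm (Sum.inl f) := add_nonneg hholε hsupN
      have he0 : 0 ≤ Real.exp (-(δc * (geo9Y x).dist (blkC x.toKIdx ιB zz.1) yL)) := (Real.exp_pos _).le
      calc M₂ * (Bpe * Real.exp (-(δc * (geo9Y x).dist (blkC x.toKIdx ιB zz.1) yL)) * ((geo9Y x).holder ε (Sum.inl f) + (geo9Y x).supNorm (Sum.inl f)))
          = (M₂ * (Bpe * 1 * ((geo9Y x).holder ε (Sum.inl f) + (geo9Y x).supNorm (Sum.inl f)))) *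
              Real.exp (-(δc * (geo9Y x).dist (blkC x.toKIdx ιB zz.1) yL)) := by ring
        _ ≤ (M₂ * (Bpe * Real.exp (δc * (2 * ((d : ℝ) + 1))) * ((geo9Y x).holder ε (Sum.inl f) + (geo9Y x).supNorm (Sum.inl f)))) *
              Real.exp (-(δc * (geo9Y x).dist (blkC x.toKIdx ιB zz.1) yL)) := by
            refine mul_le_mul_of_nonneg_right (mul_le_mul_of_nonneg_left ?_ hM₂) he0
            exact mul_le_mul_of_nonneg_right (mul_le_mul_of_nonneg_left hone hBpe0) hHS'
    · rw [diffLetter_inr, norm_symm_negGradB_G_negGradB x b TU U μ' ν _ zz.1, hliftE]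
      refine (mul_le_mul_of_nonneg_left (he4U' μ' ν zz.1) hM₂).trans (le_of_eq ?_)
      rw [hN]; ring
  -- (N₂) the probe of the unperturbed word, from the (3.45) block at the base
  set N₂ : ℝ := Bp2 * (geo9Y x).len y₁ ^ (-β') * cζ * ((geo9Y x).holder (β' + ε) (Sum.inl f) + (geo9Y x).supNorm (Sum.inl f)) with hN₂
  have hN₂0 : 0 ≤ N₂ := mul_nonneg (mul_nonneg (mul_nonneg hBp20 (Real.rpow_nonneg hleny₁.le _)) hcζ0) (add_nonneg hhol hsupN)
  have hN2 : ‖Φ ((coordEquiv b).symm ((Dl * GopC x.toKIdx parA b (.base U) * Ds) (coordEquiv b (liftY f (E : 𝔸)))))‖ ≤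
      N₂ * Real.exp (-(δc * (geo9Y x).dist y₁ yL)) := by
    rw [hGopU, hDsU, hDl, symm_gradF_G_negGradB_eq x b TU U μ ν, hliftE, map_neg, norm_neg, norm_probeH]
    refine (h2_read_Par P G x parA parH b C37 C38 hM₂ hrepr hH2' hε0 hε1 hβ0 hβ1 f ζ₀ y y' hζ hlam' E μ ν hne).trans ?_
    rw [← hlen, ← hdistL, hN₂]
    have hexp : Real.exp (-(δ * (geo9Y x).dist y₁ yL)) ≤ Real.exp (-(δc * (geo9Y x).dist y₁ yL)) :=
      Real.exp_le_exp.2 (by nlinarith [geo9Y_dist_nonneg x y₁ yL])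
    have hP : 0 ≤ (geo9Y x).len y₁ ^ (-β') * cζ * ((geo9Y x).holder (β' + ε) (Sum.inl f) + (geo9Y x).supNorm (Sum.inl f)) :=
      mul_nonneg (mul_nonneg (Real.rpow_nonneg hleny₁.le _) hcζ0) (add_nonneg hhol hsupN)
    calc Bεβ ε β' * (geo9Y x).len y₁ ^ (-β') * (geo9Y x).cutH β' (Sum.inl ζ₀) * Real.exp (-(δ * (geo9Y x).dist y₁ yL)) *
          ((geo9Y x).holder (β' + ε) (Sum.inl f) + (geo9Y x).supNorm (Sum.inl f))
        = Bεβ ε β' * (((geo9Y x).len y₁ ^ (-β') * cζ * ((geo9Y x).holder (β' + ε) (Sum.inl f) + (geo9Y x).supNorm (Sum.inl f))) *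
            Real.exp (-(δ * (geo9Y x).dist y₁ yL))) := by rw [hcζ]; ring
      _ ≤ Bp2 * (((geo9Y x).len y₁ ^ (-β') * cζ * ((geo9Y x).holder (β' + ε) (Sum.inl f) + (geo9Y x).supNorm (Sum.inl f))) *
            Real.exp (-(δc * (geo9Y x).dist y₁ yL))) :=
          mul_le_mul (le_max_left _ _) (mul_le_mul_of_nonneg_left hexp hP) (mul_nonneg hP (Real.exp_pos _).le) hBp20
      _ = _ := by ring
  -- the transfer
  have hout := HVI Dl Ds hmajL hmajR Φ y₁ (w₀, j₀) hp₀ β' BhL cζ hBhL0 hcζ0 premA yL (coordEquiv b (liftY f (E : 𝔸))) _ hBS N hN0 hN1 N₂ hN₂0 hN2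
  have hval : ‖Φ X‖ = ‖Φ ((coordEquiv b).symm ((Dl * GopC x.toKIdx parA b ((codingYx P G x C37 C38).bg.mul (.mult a) (.base U)) * Ds)
      (coordEquiv b (liftY f (E : 𝔸)))))‖ := by
    rw [hGopW, hDsU, hDl, symm_gradF_G_negGradB_eq x b TW U μ ν, hliftE, map_neg, norm_neg]
  rw [hval]
  refine hout.trans ?_
  rw [hlen, hdistL]
  -- arithmetic
  set L : ℝ := (geo9Y x).len y with hLdef
  set ee : ℝ := Real.exp (-(4 / 5 * δc * (geo9Y x).dist y y')) with hee
  have hee0 : 0 ≤ ee := (Real.exp_pos _).le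
  set HS : ℝ := (geo9Y x).holder (β' + ε) (Sum.inl f) + (geo9Y x).supNorm (Sum.inl f) with hHSdef
  have hHS0 : 0 ≤ HS := add_nonneg hhol hsupN
  have hLm : L ^ (1 - β') * L⁻¹ = L ^ (-β') := by
    rw [← Real.rpow_neg_one, ← Real.rpow_add hleny]; ring_nf
  have hNM : N + M₂ * (geo9Y x).supNorm (Sum.inl f) ≤ 3 * M₂ * (Bpe * Real.exp (δc * (2 * ((d : ℝ) + 1))) + 1) * HS := by
    rw [hN, hHSdef]
    have hc0 : 0 ≤ M₂ * (Bpe * Real.exp (δc * (2 * ((d : ℝ) + 1))) + 1) := by positivity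
    have h1 : (geo9Y x).holder ε (Sum.inl f) + (geo9Y x).supNorm (Sum.inl f) ≤
        3 * ((geo9Y x).holder (β' + ε) (Sum.inl f) + (geo9Y x).supNorm (Sum.inl f)) := by nlinarith
    have h2 : (geo9Y x).supNorm (Sum.inl f) ≤ 3 * ((geo9Y x).holder (β' + ε) (Sum.inl f) + (geo9Y x).supNorm (Sum.inl f)) := by nlinarith
    have hA : 0 ≤ M₂ * (Bpe * Real.exp (δc * (2 * ((d : ℝ) + 1)))) := by positivity
    calc M₂ * (Bpe * Real.exp (δc * (2 * ((d : ℝ) + 1))) * ((geo9Y x).holder ε (Sum.inl f) + (geo9Y x).supNorm (Sum.inl f))) +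
          M₂ * (geo9Y x).supNorm (Sum.inl f)
        = (M₂ * (Bpe * Real.exp (δc * (2 * ((d : ℝ) + 1))))) * ((geo9Y x).holder ε (Sum.inl f) + (geo9Y x).supNorm (Sum.inl f)) +
            M₂ * (geo9Y x).supNorm (Sum.inl f) := by ring
      _ ≤ (M₂ * (Bpe * Real.exp (δc * (2 * ((d : ℝ) + 1))))) * (3 * ((geo9Y x).holder (β' + ε) (Sum.inl f) + (geo9Y x).supNorm (Sum.inl f))) +
            M₂ * (3 * ((geo9Y x).holder (β' + ε) (Sum.inl f) + (geo9Y x).supNorm (Sum.inl f))) :=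
          add_le_add (mul_le_mul_of_nonneg_left h1 hA) (mul_le_mul_of_nonneg_left h2 hM₂)
      _ = 3 * M₂ * (Bpe * Real.exp (δc * (2 * ((d : ℝ) + 1))) + 1) * ((geo9Y x).holder (β' + ε) (Sum.inl f) + (geo9Y x).supNorm (Sum.inl f)) := by
          ring
  have hNMnn : 0 ≤ N + M₂ * (geo9Y x).supNorm (Sum.inl f) := add_nonneg hN0 (mul_nonneg hM₂ hsupN)
  have hterm2 : BhL * L ^ (1 - β') * cζ * L⁻¹ * (N + M₂ * (geo9Y x).supNorm (Sum.inl f)) ≤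
      BhL * cζ * L ^ (-β') * (3 * M₂ * (Bpe * Real.exp (δc * (2 * ((d : ℝ) + 1))) + 1) * HS) := by
    calc BhL * L ^ (1 - β') * cζ * L⁻¹ * (N + M₂ * (geo9Y x).supNorm (Sum.inl f))
        = BhL * cζ * (L ^ (1 - β') * L⁻¹) * (N + M₂ * (geo9Y x).supNorm (Sum.inl f)) := by ring
      _ = BhL * cζ * L ^ (-β') * (N + M₂ * (geo9Y x).supNorm (Sum.inl f)) := by rw [hLm]
      _ ≤ BhL * cζ * L ^ (-β') * (3 * M₂ * (Bpe * Real.exp (δc * (2 * ((d : ℝ) + 1))) + 1) * HS) :=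
          mul_le_mul_of_nonneg_left hNM (mul_nonneg (mul_nonneg hBhL0 hcζ0) (Real.rpow_nonneg hleny.le _))
  have hterm1 : N₂ = Bp2 * L ^ (-β') * cζ * HS := by rw [hN₂, hlen]
  calc B * (N₂ + BhL * L ^ (1 - β') * cζ * L⁻¹ * (N + M₂ * (geo9Y x).supNorm (Sum.inl f))) * ee
      ≤ B * (Bp2 * L ^ (-β') * cζ * HS + BhL * cζ * L ^ (-β') * (3 * M₂ * (Bpe * Real.exp (δc * (2 * ((d : ℝ) + 1))) + 1) * HS)) * ee := by
        refine mul_le_mul_of_nonneg_right (mul_le_mul_of_nonneg_left ?_ hB) hee0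
        rw [hterm1]
        exact add_le_add le_rfl hterm2
    _ = wH2₇ (2 * ((d : ℝ) + 1)) Sb M₂ B δc Bβ Bε Bεβ ε β' * L ^ (-β') * cζ * ee * HS := by
        rw [wH2₇, ← hBp, ← hBpe, ← hBp2, hBhL]; ring

end Transfer

/-! ## §3 ★★ The frame instance over the coded carriers of a subfamily and the (3.45) block-steps -/

section Steps

variable [NormOneClass 𝔸] {J : Type} (f : J → MemberY d ℓ hd hL b₀ b₁ Mstar) [∀ x : MemberY d ℓ hd hL b₀ b₁ Mstar, Fintype (geo9Y x).Site]
  [instDS : ∀ x : MemberY d ℓ hd hL b₀ b₁ Mstar, DecidableEq (geo9Y x).Site] [instNE : ∀ x : MemberY d ℓ hd hL b₀ b₁ Mstar, Nonempty (geo9Y x).Site]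
  (c35 : ℝ) (G : Subgroup 𝔸ˣ) (parA parH : ∀ j : J, SiteParY 𝔸 (f j).toKIdx) (OA : ∀ j : J, BondOpY 𝔸 (f j).toKIdx)
  (parB : ∀ j : J, BondParY 𝔸 (f j).toKIdx) {ι : Type} [Fintype ι] [DecidableEq ι] (b : Module.Basis ι ℝ 𝔸)
  (ιB : ∀ j : J, BlkY (f j).toKIdx → IBondY (f j).toKIdx)
  (C37 C38 : ∀ j : J, ℝ → CfgY 𝔸 (f j).toKIdx → AfldY 𝔸 (f j).toKIdx → Prop)
  (Cinv : ∀ j : J, B9.SiteKernel (geo9Y (f j)) (bg9YC 𝔸 G P (f j)))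

/-- ★★ **THE (3.45) FRAME OVER THE CODED CARRIERS OF A SUBFAMILY, INHABITED FOR `KSC₇Par parA parH`** (root frame at `parA`; laws `hpar hunit hC37` at `parA`; no `parH` law) (root frame `gpFrame₂CodedOn` with `KSC₇`'s dictionaries, writing function
`wH2₇`, rate `4δc∕5`, transfer field `h2_transfer_KSC₇`); no hypothesis beyond the root frame's.
[cite: Balaban1985BackgroundPropagators, Thm 3.4 p.400, (3.45) p.398, p.403 l.2–5, (3.60)–(3.65) pp.402–403; Balaban1984PropagatorsII, Lemma 2.1 p.234, (2.51)–(2.52) p.232] -/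
noncomputable def h2Frame₃CodedOnPar (hι : ∀ (j : J) (s : BlkY (f j).toKIdx), β (f j).toKIdx.hN (f j).toKIdx.D (f j).toKIdx.hk (ιB j s) = s)
    (hG1 : ∀ u : 𝔸ˣ, u ∈ G → ‖(u : 𝔸)‖ ≤ 1) (hpar : ∀ j (U : CfgY 𝔸 (f j).toKIdx), GVal G (f j).toKIdx U → ∀ z w, parA j U z w ∈ G)
    (hunit : ∀ j (U : CfgY 𝔸 (f j).toKIdx), GVal G (f j).toKIdx U → IsUnit (deltaPrimeAY (f j).toKIdx (parA j) U))
    (dB : ℕ) (M₂ : ℝ) (hM₂ : 0 ≤ M₂) (hrepr : ∀ (v : 𝔸) (j : ι), |b.repr v j| ≤ M₂ * ‖v‖) (hcR : 0 < M₂ * ∑ j, ‖b j‖)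
    (Cq : ℝ) (hCq : 0 ≤ Cq) (hC37 : ∀ j β' U a, C37 j β' U a → GVal G (f j).toKIdx U ∧ CplxLettersY G (f j) (parA j) (ιB j) Cq β' U a)
    (MInv aInv aW : ℝ) (hMInv : 0 < MInv) (haInv : 0 < aInv) (haW : 0 < aW) :
    H2Frame₃ c35 (fun j => geo9Y (f j)) (fun j => (codingYx P G (f j) (C37 j) (C38 j)).bg) (fun j => KSC₇Par P G (f j) (parA j) (parH j) (C37 j) (C38 j)) b
      (Fin (d + 1)) (fun j => SiteY (f j).toKIdx) :=
  { gpFrame₂CodedOn P f c35 G b C37 C38 parA ιB (fun j => KSC₇Par P G (f j) (parA j) (parH j) (C37 j) (C38 j)) hι hG1 hpar hunit dB M₂ hM₂ hrepr Cq hCq hC37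
      (M₂ * ∑ j, ‖b j‖) hcR (fun B _ => (M₂ * ∑ j, ‖b j‖) * B + 1) (fun B _ hB _ => by positivity) (fun δ => δ) (fun δ hδ => hδ)
      MInv aInv aW hMInv haInv haW (fun j => read342Y_KSC₇Par P G (f j) (parA j) (parH j) b (ιB j) (C37 j) (C38 j) (hι j) M₂ hM₂ hrepr c35 MInv aInv)
      (fun j => write342Y_KSC₇Par P G (f j) (parA j) (parH j) b (ιB j) (C37 j) (C38 j) (hι j) M₂ hM₂ hrepr aW fun β' U a h => (hC37 j β' U a h).1) with
    wH2 := fun B δc Bβ Bε Bεβ => wH2₇ (2 * ((d : ℝ) + 1)) (∑ j, ‖b j‖) M₂ B δc Bβ Bε Bεβ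
    wH2δ := fun δc => 4 / 5 * δc
    wH2δ_pos := fun δc hδc => by positivity
    h2_transfer := fun j α₀ c c' α₁ B₀ B δ δc Bβ Bε Bεβ hM hα₀ hMa hreg hα₁ haW' h37 hB₀ hB hδ hδc hδcδ hE hHol HVI =>
      h2_transfer_KSC₇Par P c35 G (f j) (parA j) (parH j) b (ιB j) (C37 j) (C38 j) (hι j) hG1 hM₂ hrepr hcR
        (read342Y_KSC₇Par P G (f j) (parA j) (parH j) b (ιB j) (C37 j) (C38 j) (hι j) M₂ hM₂ hrepr c35 MInv aInv)
        α₀ c c' α₁ B₀ B δ δc Bβ Bε Bεβ hM hα₀ hMa hreg hα₁ haW' h37 hB₀ hB hδ hδc hδcδ hE hHol HVI }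

/-- ★★ **`StepH2Pos` OF `KSC₇Par parA parH` OVER THE CODED CARRIERS** (any shared `GA`, `Cinv`). [cite: Balaban1985BackgroundPropagators, Thm 3.4 p.400, (3.45) p.398, p.403 l.2–5; Balaban1984PropagatorsII, Lemma 2.1 p.234] -/
theorem stepH2Pos_KSC₇Par_on (hι : ∀ (j : J) (s : BlkY (f j).toKIdx), β (f j).toKIdx.hN (f j).toKIdx.D (f j).toKIdx.hk (ιB j s) = s)
    (hG1 : ∀ u : 𝔸ˣ, u ∈ G → ‖(u : 𝔸)‖ ≤ 1) (hpar : ∀ j (U : CfgY 𝔸 (f j).toKIdx), GVal G (f j).toKIdx U → ∀ z w, parA j U z w ∈ G)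
    (hunit : ∀ j (U : CfgY 𝔸 (f j).toKIdx), GVal G (f j).toKIdx U → IsUnit (deltaPrimeAY (f j).toKIdx (parA j) U))
    (dB : ℕ) (M₂ : ℝ) (hM₂ : 0 ≤ M₂) (hrepr : ∀ (v : 𝔸) (j : ι), |b.repr v j| ≤ M₂ * ‖v‖) (hcR : 0 < M₂ * ∑ j, ‖b j‖)
    (Cq : ℝ) (hCq : 0 ≤ Cq) (hC37 : ∀ j β' U a, C37 j β' U a → GVal G (f j).toKIdx U ∧ CplxLettersY G (f j) (parA j) (ιB j) Cq β' U a)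
    (MInv aInv aW : ℝ) (hMInv : 0 < MInv) (haInv : 0 < aInv) (haW : 0 < aW)
    (GA : ∀ j : J, B9.KernelFamily (geo9Y (f j)) (codingYx P G (f j) (C37 j) (C38 j)).bg)
    (CinvC : ∀ j : J, B9.SiteKernel (geo9Y (f j)) (codingYx P G (f j) (C37 j) (C38 j)).bg) :
    StepH2Pos dB c35 (fun j => geo9Y (f j)) (fun j => (codingYx P G (f j) (C37 j) (C38 j)).bg) (fun j => KSC₇Par P G (f j) (parA j) (parH j) (C37 j) (C38 j)) GA CinvC
      (fun j => KSC₇Par P G (f j) (parA j) (parH j) (C37 j) (C38 j)) :=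
  stepH2Pos_of_h2Frame₃ (d := dB)
    (h2Frame₃CodedOnPar P f c35 G parA parH b ιB C37 C38 hι hG1 hpar hunit dB M₂ hM₂ hrepr hcR Cq hCq hC37 MInv aInv aW hMInv haInv haW) GA CinvC

/-- ★★★ **`StepH2Pos` OF THE TWO-TRANSPORTER READING OVER THE CODED CARRIER — THE (3.45) MEMBER OF THE SECT.-B STEP OF RECORD FOR `(KSCUPar parA parH, KACU, C⁻¹)`**
(input families `(KSCUPar, KACU, pullS Cinv)`, output `KSCUPar`'s (3.45) block at the product): `stepH2Pos_KSC₇Par_on` (with `GA := KACU`, `Cinv := pullS Cinv`)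
transported by `stepH2Pos_of_family_pos` — `hin_KSCUPar_on_pos`, identity output (`KSC₇Par.h2 = KSCUPar.h2`).  Binders = those of
`B9SectBCodedFamiliesUParH.stepEPos_KSCUPar_on` (laws `hpar hunit hC37` at the AVERAGING transporter `parA`); no law of `parH`.
[cite: Balaban1985BackgroundPropagators, Thm 3.4 p.400, (3.45) p.398, (3.40) p.397, (3.21) p.394, p.403 l.2–5, (3.60)–(3.65) pp.402–403, (3.35)–(3.37) p.396; Balaban1984PropagatorsII, Lemma 2.1 p.234, (2.51)–(2.52) p.232] -/
theorem stepH2Pos_KSCUPar_on (hι : ∀ (j : J) (s : BlkY (f j).toKIdx), β (f j).toKIdx.hN (f j).toKIdx.D (f j).toKIdx.hk (ιB j s) = s)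
    (hG1 : ∀ u : 𝔸ˣ, u ∈ G → ‖(u : 𝔸)‖ ≤ 1) (hpar : ∀ j (U : CfgY 𝔸 (f j).toKIdx), GVal G (f j).toKIdx U → ∀ z w, parA j U z w ∈ G)
    (hunit : ∀ j (U : CfgY 𝔸 (f j).toKIdx), GVal G (f j).toKIdx U → IsUnit (deltaPrimeAY (f j).toKIdx (parA j) U))
    (dB : ℕ) (M₂ : ℝ) (hM₂ : 0 ≤ M₂) (hrepr : ∀ (v : 𝔸) (j : ι), |b.repr v j| ≤ M₂ * ‖v‖) (hcR : 0 < M₂ * ∑ j, ‖b j‖)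
    (Cq : ℝ) (hCq : 0 ≤ Cq) (hC37 : ∀ j β' U a, C37 j β' U a → GVal G (f j).toKIdx U ∧ CplxLettersY G (f j) (parA j) (ιB j) Cq β' U a)
    (MInv aInv aW : ℝ) (hMInv : 0 < MInv) (haInv : 0 < aInv) (haW : 0 < aW) :
    StepH2Pos dB c35 (fun j => geo9Y (f j)) (fun j => (codingYx P G (f j) (C37 j) (C38 j)).bg)
      (fun j => KSCUPar P G (f j) (parA j) (parH j) (C37 j) (C38 j)) (fun j => KACU P G (f j) (OA j) (parB j) (C37 j) (C38 j))
      (fun j => pullS (codingYx P G (f j) (C37 j) (C38 j)) (Cinv j)) (fun j => KSCUPar P G (f j) (parA j) (parH j) (C37 j) (C38 j)) :=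
  stepH2Pos_of_family_pos dB c35 (fun j => geo9Y (f j)) (fun j => (codingYx P G (f j) (C37 j) (C38 j)).bg)
    (fun j => KSC₇Par P G (f j) (parA j) (parH j) (C37 j) (C38 j)) (fun j => KSCUPar P G (f j) (parA j) (parH j) (C37 j) (C38 j))
    (fun j => KACU P G (f j) (OA j) (parB j) (C37 j) (C38 j)) (fun j => KACU P G (f j) (OA j) (parB j) (C37 j) (C38 j))
    (fun j => pullS (codingYx P G (f j) (C37 j) (C38 j)) (Cinv j))
    (fun j => KSC₇Par P G (f j) (parA j) (parH j) (C37 j) (C38 j)) (fun j => KSCUPar P G (f j) (parA j) (parH j) (C37 j) (C38 j))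
    (hin_KSCUPar_on_pos P f c35 G parA parH OA parB b ιB C37 C38 Cinv hι hG1 hM₂ hrepr dB)
    (fun Bεβ δ a hδ ha => ⟨0, 1, a, Bεβ, δ, one_pos, ha, le_rfl, hδ,
      fun j _ _ _ _ _ _ _ _ _ _ _ h => (h2Block_KSC₇Par_iff P G (f j) (parA j) (parH j) (C37 j) (C38 j) _).1 h⟩)
    (stepH2Pos_KSC₇Par_on P f c35 G parA parH b ιB C37 C38 hι hG1 hpar hunit dB M₂ hM₂ hrepr hcR Cq hCq hC37 MInv aInv aW hMInv haInv haW _ _)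

end Steps

end Literature.MathematicalPhysics.QuantumFieldTheory.Balaban1983to89.B9SectBH2StepUParH

end
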